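import Summits.QuantumFields.YangMills.Theorems.SwapVirialDeficitZeroModeGroupFourSmallBallScaling
import HarnessLib

/-!
# Exact zero-mode rung, FOUR pairwise nearly commuting letters — III: the SECOND blow-up (central hubs) and the EXACT two-scale identity
# (zero-mode block of crux ⟨stmt-QuantumFields-24497⟩ `ToronTubeVolumeLaw` — «exponent EXACTLY 6 with EXACTLY ONE logarithm»; free-hands support of
# ⟨stmt-QuantumFields-24197⟩ / ⟨24497⟩)

Part II factored `t⁶` out of `Haar⁴(N₄(t))` exactly; the logarithm is carried by the hub integral `∫dcone(a) vol³(G⁴_{t²}(a))` of the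
`t`-regular event `G⁴_s(a) = rescaledSet4 s a`, whose `s → 0` limit has a non-integrable pole at the CENTRAL hubs `‖Im a‖ → 0`.  This file
resolves that pole by a SECOND, hub-dependent linear change of variables of the three non-hub letters,
`S = diag(1, m, l, l)` with `m = a_I/‖a‖`, `l = ‖a‖/(2a_I)` (so `4m²l² = 1`, `det S = ‖a‖/(4a_I)`), which turns `G⁴_s(a)` into a
THREE-parameter event `twoScaleSet4 η ζ κ` that no longer mentions the hub:
* §7 `diag4g`, `scaleQ m l` (`det = m·l²`, coordinates), push-forwards `map_scaleQ_volume`, `map_scaleQ3_volume`;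
* §8 `tsNorm η ζ x = x₀² + η·x_I² + ζ·(x_J² + x_K²)`, ★ `twoScaleSet4 η ζ κ` (balls `tsNorm < 1`, hubs `x_J² + x_K² ≤ tsNorm x`, pairs
  `(x_Ky_I − x_Iy_K)² + (x_Iy_J − x_Jy_I)² + κ·(x_Jy_K − x_Ky_J)² ≤ tsNorm x · tsNorm y`), measurability;
* §9 ★ `scaleQ3_mem_rescaledSet4_iff` and ★★ `volume_rescaledSet4_eq_twoScale` — for an axis hub with `a_I > 0` and ANY `s`,
  `vol³(G⁴_s(a)) = (‖a‖/(4a_I))³ · vol³(twoScaleSet4 (a_I²/‖a‖²) (s‖a‖²/(4a_I²)) (s‖a‖⁴/(4a_I⁴)))`;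
* §10 ★★★ `haar_nearlyCommuting_eq_twoScale` — for `t > 0`,
  `Haar⁴(N₄(t)) = t⁶ · coneConst³ · ∫dcone(a) (‖a‖/(4‖Im a‖))³ · vol³(twoScaleSet4 (‖Im a‖²/‖a‖²) (t²‖a‖²/(4‖Im a‖²)) (t²‖a‖⁴/(4‖Im a‖⁴)))`.
WHY THIS IS THE LOG (memo, not a theorem here): with `η = ‖Im a‖²/‖a‖² → 0` at FIXED `κ = t²‖a‖⁴/(4‖Im a‖⁴)` (and `ζ = κη → 0`) the event tends to the
`η`-free set `twoScaleSet4 0 0 κ` = {`x₀² < 1`, `x_J² + x_K² ≤ x₀²`, `(x_Ky_I − x_Iy_K)² + (x_Iy_J − x_Jy_I)² + κ(x_Jy_K − x_Ky_J)² ≤ x₀²y₀²`, …} of volume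
`h(κ)`, so the hub integral is `≈ (1/64)∫ h(t²‖a‖⁴/4‖Im a‖⁴)·‖a‖³‖Im a‖⁻³ dcone(a) ≈ const·∫_{√t}^{1} dα/α = const·½·log(1/t)`: the small-ball power
`t⁶` comes from part II's Jacobian, the power `‖Im a‖⁻³` (exactly cancelling the cone density `‖Im a‖² d‖Im a‖`) from this file's Jacobian, and the
lower cutoff `‖Im a‖ ≈ √t` from the `κ`-term of the pair constraints.  The remaining analytic steps (an `η`-uniform integrable majorant on
`(ℍ × ℍ) × ℍ`, `h(κ) → h(0)` with a rate, `h(κ) → 0` at `κ → ∞`) are NOT done here.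
HONEST LABEL: finite-dimensional measure theory on `SU(2)⁴` (plan-level zero-mode rung of DRAFT lines); NOT ⟨24497⟩, NOT ⟨24197⟩; the Yang–Mills mass gap
is NOT proved; no summit is proved by a line.  Seat ym-line-fcl-p3 g44 (cell ym-idea-1, free hands), `--supports stmt-QuantumFields-24197`.  Standard axioms.
References: [cite: GonzalezarroyoAltes1988]; [cite: Vanbaal2001]; [cite: Luscher1983, §2]; [folklore].
-/

set_option autoImplicit false

noncomputable section

open MeasureTheory Quaternion Set
open scoped Quaternion ENNReal BigOperators
open Literature.MathematicalPhysics.QuantumLattice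
open Literature.MathematicalPhysics.QuantumFieldTheory (haarProbability)
open Summit.QuantumFields.YangMills.Theorems.SwapTwistDeficit.ToronLog

attribute [local instance] Literature.Analysis.FluidPDE.Tao2016.quatMeasurableSpace
  Literature.Analysis.FluidPDE.Tao2016.quatBorelSpace
  Literature.MathematicalPhysics.QuantumLattice.secondCountableTopology_su2

namespace Summit.QuantumFields.YangMills.Theorems.SwapVirialDeficit.ZeroModeGroup

/-! ## §7 The two-parameter diagonal scaling `S_{m,l} = diag(1, m, l, l)` -/

/-- The diagonal map `diag(1, m, l, l)` on `ℝ⁴` (cf. ✓`diag4 t = diag(1, 1, t, t)`). [folklore] -/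
def diag4g (m l : ℝ) : EuclideanSpace ℝ (Fin 4) →ₗ[ℝ] EuclideanSpace ℝ (Fin 4) :=
  eX4.toLinearMap ∘ₗ (Matrix.toLin' (Matrix.diagonal ![1, m, l, l]) ∘ₗ eX4.symm.toLinearMap)

/-- `diag4g` in coordinates. [folklore] -/
theorem diag4g_apply (m l : ℝ) (u : EuclideanSpace ℝ (Fin 4)) (i : Fin 4) : (diag4g m l u) i = (![1, m, l, l] i) * u i := by
  simp [diag4g, eX4, Matrix.toLin'_apply, Matrix.mulVec_diagonal]

/-- `det diag(1, m, l, l) = m·l²`. [folklore] -/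
theorem det_diag4g (m l : ℝ) : LinearMap.det (diag4g m l) = m * l ^ 2 := by
  unfold diag4g
  rw [LinearMap.det_conj (Matrix.toLin' (Matrix.diagonal ![1, m, l, l])) eX4, LinearMap.det_toLin', Matrix.det_diagonal,
    Fin.prod_univ_four]
  simp; ring

/-- **The second blow-up** `S_{m,l}(x₀, x_I, x_J, x_K) = (x₀, m·x_I, l·x_J, l·x_K)` as a linear map of `ℍ` (✓`dilate t = S_{1,t}`). [folklore] -/
def scaleQ (m l : ℝ) : ℍ →ₗ[ℝ] ℍ :=
  Quaternion.linearIsometryEquivTuple.toLinearEquiv.symm.toLinearMap ∘ₗ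
    (diag4g m l ∘ₗ Quaternion.linearIsometryEquivTuple.toLinearEquiv.symm.symm.toLinearMap)

/-- `det S_{m,l} = m·l²`. [folklore] -/
theorem det_scaleQ (m l : ℝ) : LinearMap.det (scaleQ m l) = m * l ^ 2 := by
  unfold scaleQ
  rw [LinearMap.det_conj (diag4g m l) Quaternion.linearIsometryEquivTuple.toLinearEquiv.symm, det_diag4g]

/-- `S_{m,l}` in coordinates. [folklore] -/
theorem scaleQ_apply (m l : ℝ) (x : ℍ) : scaleQ m l x = ⟨x.re, m * x.imI, l * x.imJ, l * x.imK⟩ := by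
  have h : scaleQ m l x = Quaternion.linearIsometryEquivTuple.symm (diag4g m l (Quaternion.linearIsometryEquivTuple x)) := rfl
  rw [h, Quaternion.linearIsometryEquivTuple_symm_apply]
  have hc : ∀ i : Fin 4, (diag4g m l (Quaternion.linearIsometryEquivTuple x)) i = (![1, m, l, l] i) * (Quaternion.linearIsometryEquivTuple x) i :=
    fun i => diag4g_apply m l _ i
  rw [hc 0, hc 1, hc 2, hc 3]
  simp [Quaternion.linearIsometryEquivTuple_apply]

/-- Components of `S_{m,l} x`. [folklore] -/
theorem scaleQ_re (m l : ℝ) (x : ℍ) : (scaleQ m l x).re = x.re := by rw [scaleQ_apply]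
/-- Components of `S_{m,l} x`. [folklore] -/
theorem scaleQ_imI (m l : ℝ) (x : ℍ) : (scaleQ m l x).imI = m * x.imI := by rw [scaleQ_apply]
/-- Components of `S_{m,l} x`. [folklore] -/
theorem scaleQ_imJ (m l : ℝ) (x : ℍ) : (scaleQ m l x).imJ = l * x.imJ := by rw [scaleQ_apply]
/-- Components of `S_{m,l} x`. [folklore] -/
theorem scaleQ_imK (m l : ℝ) (x : ℍ) : (scaleQ m l x).imK = l * x.imK := by rw [scaleQ_apply]

/-- `S_{m,l}` is measurable. [folklore] -/
theorem measurable_scaleQ (m l : ℝ) : Measurable (scaleQ m l) := (LinearMap.continuous_of_finiteDimensional _).measurable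

/-- `(S_{m,l})_* vol = |m·l²|⁻¹ · vol` (`m·l² ≠ 0`). [folklore] -/
theorem map_scaleQ_volume {m l : ℝ} (h : m * l ^ 2 ≠ 0) :
    Measure.map (scaleQ m l) (volume : Measure ℍ) = ENNReal.ofReal (|m * l ^ 2|⁻¹) • (volume : Measure ℍ) := by
  have hdet : LinearMap.det (scaleQ m l) ≠ 0 := by rwa [det_scaleQ]
  rw [show (⇑(scaleQ m l)) = ⇑(scaleQ m l) from rfl, Measure.map_linearMap_addHaar_eq_smul_addHaar _ hdet, det_scaleQ, abs_inv]

/-- The product blow-up `S × S × S` on `(ℍ × ℍ) × ℍ`. [folklore] -/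
def scaleQ3 (m l : ℝ) : (ℍ × ℍ) × ℍ → (ℍ × ℍ) × ℍ := Prod.map (Prod.map (scaleQ m l) (scaleQ m l)) (scaleQ m l)

/-- Unfolding `scaleQ3`. [folklore] -/
theorem scaleQ3_apply (m l : ℝ) (w : (ℍ × ℍ) × ℍ) : scaleQ3 m l w = ((scaleQ m l w.1.1, scaleQ m l w.1.2), scaleQ m l w.2) := rfl

/-- `scaleQ3` is measurable. [folklore] -/
theorem measurable_scaleQ3 (m l : ℝ) : Measurable (scaleQ3 m l) :=
  ((measurable_scaleQ m l).prodMap (measurable_scaleQ m l)).prodMap (measurable_scaleQ m l)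

/-- `(S × S × S)_* vol³ = (|m·l²|⁻¹)³ · vol³` (`m·l² ≠ 0`). [folklore] -/
theorem map_scaleQ3_volume {m l : ℝ} (h : m * l ^ 2 ≠ 0) :
    Measure.map (scaleQ3 m l) (((volume : Measure ℍ).prod (volume : Measure ℍ)).prod (volume : Measure ℍ)) =
      (ENNReal.ofReal (|m * l ^ 2|⁻¹) * ENNReal.ofReal (|m * l ^ 2|⁻¹) * ENNReal.ofReal (|m * l ^ 2|⁻¹)) •
        (((volume : Measure ℍ).prod (volume : Measure ℍ)).prod (volume : Measure ℍ)) := by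
  have hD := measurable_scaleQ m l
  rw [scaleQ3, ← Measure.map_prod_map _ _ (hD.prodMap hD) hD, ← Measure.map_prod_map _ _ hD hD, map_scaleQ_volume h]
  simp only [Measure.prod_smul_left, Measure.prod_smul_right, smul_smul]
  congr 1
  ring

/-! ## §8 The doubly rescaled norm and the three-parameter event -/

/-- The doubly rescaled squared norm `M_{η,ζ}(x) = x₀² + η·x_I² + ζ·(x_J² + x_K²)` (`N_s(S_{m,l}x) = M_{m², s l²}(x)`). [folklore] -/
def tsNorm (η ζ : ℝ) (x : ℍ) : ℝ := x.re ^ 2 + η * x.imI ^ 2 + ζ * (x.imJ ^ 2 + x.imK ^ 2)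

/-- `N_s(S_{m,l} x) = M_{m², s·l²}(x)`. [folklore] -/
theorem dilNormSq_scaleQ (s m l : ℝ) (x : ℍ) : dilNormSq s (scaleQ m l x) = tsNorm (m ^ 2) (s * l ^ 2) x := by
  rw [dilNormSq, tsNorm, scaleQ_re, scaleQ_imI, scaleQ_imJ, scaleQ_imK]; ring

/-- `tsNorm η ζ` is continuous. [folklore] -/
theorem continuous_tsNorm (η ζ : ℝ) : Continuous (tsNorm η ζ) := by
  unfold tsNorm
  exact ((Quaternion.continuous_re.pow 2).add (continuous_const.mul (Quaternion.continuous_imI.pow 2))).add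
    (continuous_const.mul ((Quaternion.continuous_imJ.pow 2).add (Quaternion.continuous_imK.pow 2)))

/-- At `η = ζ = 0`: `M_{0,0}(x) = x₀²`. [folklore] -/
theorem tsNorm_zero_zero (x : ℍ) : tsNorm 0 0 x = x.re ^ 2 := by unfold tsNorm; ring

/-- ★ **The three-parameter event after the second blow-up** `T(η, ζ, κ) ⊆ (ℍ × ℍ) × ℍ` — it does not mention the hub: balls `M_{η,ζ} < 1`,
hubs `x_J² + x_K² ≤ M_{η,ζ}(x)`, pairs `(x_Ky_I − x_Iy_K)² + (x_Iy_J − x_Jy_I)² + κ·(x_Jy_K − x_Ky_J)² ≤ M_{η,ζ}(x)·M_{η,ζ}(y)`.  Its `η = ζ = 0`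
slice `T(0, 0, κ)` is the limit event whose volume `h(κ)` carries the coefficient of the logarithm. [folklore] -/
def twoScaleSet4 (η ζ κ : ℝ) : Set ((ℍ × ℍ) × ℍ) :=
  {w | tsNorm η ζ w.1.1 < 1 ∧ tsNorm η ζ w.1.2 < 1 ∧ tsNorm η ζ w.2 < 1 ∧
    w.1.1.imJ ^ 2 + w.1.1.imK ^ 2 ≤ tsNorm η ζ w.1.1 ∧
    w.1.2.imJ ^ 2 + w.1.2.imK ^ 2 ≤ tsNorm η ζ w.1.2 ∧
    w.2.imJ ^ 2 + w.2.imK ^ 2 ≤ tsNorm η ζ w.2 ∧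
    (w.1.1.imK * w.1.2.imI - w.1.1.imI * w.1.2.imK) ^ 2 + (w.1.1.imI * w.1.2.imJ - w.1.1.imJ * w.1.2.imI) ^ 2 +
        κ * (w.1.1.imJ * w.1.2.imK - w.1.1.imK * w.1.2.imJ) ^ 2 ≤ tsNorm η ζ w.1.1 * tsNorm η ζ w.1.2 ∧
    (w.1.1.imK * w.2.imI - w.1.1.imI * w.2.imK) ^ 2 + (w.1.1.imI * w.2.imJ - w.1.1.imJ * w.2.imI) ^ 2 +
        κ * (w.1.1.imJ * w.2.imK - w.1.1.imK * w.2.imJ) ^ 2 ≤ tsNorm η ζ w.1.1 * tsNorm η ζ w.2 ∧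
    (w.1.2.imK * w.2.imI - w.1.2.imI * w.2.imK) ^ 2 + (w.1.2.imI * w.2.imJ - w.1.2.imJ * w.2.imI) ^ 2 +
        κ * (w.1.2.imJ * w.2.imK - w.1.2.imK * w.2.imJ) ^ 2 ≤ tsNorm η ζ w.1.2 * tsNorm η ζ w.2}

/-- `twoScaleSet4 η ζ κ` is measurable. [folklore] -/
theorem measurableSet_twoScaleSet4 (η ζ κ : ℝ) : MeasurableSet (twoScaleSet4 η ζ κ) := by
  have hx : Measurable fun w : (ℍ × ℍ) × ℍ => w.1.1 := measurable_fst.comp measurable_fst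
  have hy : Measurable fun w : (ℍ × ℍ) × ℍ => w.1.2 := measurable_snd.comp measurable_fst
  have hz : Measurable fun w : (ℍ × ℍ) × ℍ => w.2 := measurable_snd
  have hN : ∀ {f : (ℍ × ℍ) × ℍ → ℍ}, Measurable f → Measurable fun w => tsNorm η ζ (f w) :=
    fun hf => (continuous_tsNorm η ζ).measurable.comp hf
  have hc : ∀ {f : (ℍ × ℍ) × ℍ → ℍ}, Measurable f → ∀ (g : ℍ → ℝ), Continuous g → Measurable fun w => g (f w) :=
    fun hf g hg => hg.measurable.comp hf
  have hI : Continuous fun q : ℍ => q.imI := Quaternion.continuous_imI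
  have hJc : Continuous fun q : ℍ => q.imJ := Quaternion.continuous_imJ
  have hKc : Continuous fun q : ℍ => q.imK := Quaternion.continuous_imK
  have hub : ∀ {f : (ℍ × ℍ) × ℍ → ℍ}, Measurable f →
      MeasurableSet {w : (ℍ × ℍ) × ℍ | (f w).imJ ^ 2 + (f w).imK ^ 2 ≤ tsNorm η ζ (f w)} :=
    fun hf => measurableSet_le (((hc hf _ hJc).pow_const 2).add ((hc hf _ hKc).pow_const 2)) (hN hf)
  have cpl : ∀ {f g : (ℍ × ℍ) × ℍ → ℍ}, Measurable f → Measurable g →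
      MeasurableSet {w : (ℍ × ℍ) × ℍ | ((f w).imK * (g w).imI - (f w).imI * (g w).imK) ^ 2 +
        ((f w).imI * (g w).imJ - (f w).imJ * (g w).imI) ^ 2 + κ * ((f w).imJ * (g w).imK - (f w).imK * (g w).imJ) ^ 2 ≤
          tsNorm η ζ (f w) * tsNorm η ζ (g w)} := by
    intro f g hf hg
    refine measurableSet_le ?_ ((hN hf).mul (hN hg))
    exact ((((hc hf _ hKc).mul (hc hg _ hI)).sub ((hc hf _ hI).mul (hc hg _ hKc))).pow_const 2 |>.add
      ((((hc hf _ hI).mul (hc hg _ hJc)).sub ((hc hf _ hJc).mul (hc hg _ hI))).pow_const 2)) |>.add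
      (((((hc hf _ hJc).mul (hc hg _ hKc)).sub ((hc hf _ hKc).mul (hc hg _ hJc))).pow_const 2).const_mul κ)
  unfold twoScaleSet4
  exact (measurableSet_lt (hN hx) measurable_const).inter ((measurableSet_lt (hN hy) measurable_const).inter
    ((measurableSet_lt (hN hz) measurable_const).inter ((hub hx).inter ((hub hy).inter ((hub hz).inter
      ((cpl hx hy).inter ((cpl hx hz).inter (cpl hy hz))))))))

/-! ## §9 The second blow-up, pointwise and in measure -/

/-- The hub constraint after the blow-up: with `4a_I²l² = ‖a‖² ≠ 0`,
`4a_I²((l x_J)² + (l x_K)²) ≤ N·‖a‖² ↔ x_J² + x_K² ≤ N`. [folklore] -/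
theorem hub_scale_iff {a : ℍ} {l : ℝ} (hl : 4 * (a.imI ^ 2 * l ^ 2) = ‖a‖ ^ 2) (ha : ‖a‖ ≠ 0) (N xJ xK : ℝ) :
    4 * (a.imI ^ 2 * ((l * xJ) ^ 2 + (l * xK) ^ 2)) ≤ N * ‖a‖ ^ 2 ↔ xJ ^ 2 + xK ^ 2 ≤ N := by
  have e : 4 * (a.imI ^ 2 * ((l * xJ) ^ 2 + (l * xK) ^ 2)) = (xJ ^ 2 + xK ^ 2) * ‖a‖ ^ 2 := by rw [← hl]; ring
  rw [e]
  have hpos : 0 < ‖a‖ ^ 2 := by positivity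
  constructor
  · intro h; exact le_of_mul_le_mul_right h hpos
  · intro h; exact mul_le_mul_of_nonneg_right h hpos.le

/-- The pair constraint after the blow-up: with `4m²l² = 1`, the three brackets rescale by `l²m², l²m², l⁴`. [folklore] -/
theorem pair_scale_eq {m l : ℝ} (hml : 4 * (m ^ 2 * l ^ 2) = 1) (s xI xJ xK yI yJ yK : ℝ) :
    4 * ((l * xK * (m * yI) - m * xI * (l * yK)) ^ 2 + (m * xI * (l * yJ) - l * xJ * (m * yI)) ^ 2 +
        s * (l * xJ * (l * yK) - l * xK * (l * yJ)) ^ 2) =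
      (xK * yI - xI * yK) ^ 2 + (xI * yJ - xJ * yI) ^ 2 + 4 * s * l ^ 4 * (xJ * yK - xK * yJ) ^ 2 := by
  have e : 4 * ((l * xK * (m * yI) - m * xI * (l * yK)) ^ 2 + (m * xI * (l * yJ) - l * xJ * (m * yI)) ^ 2 +
      s * (l * xJ * (l * yK) - l * xK * (l * yJ)) ^ 2) =
      4 * (m ^ 2 * l ^ 2) * ((xK * yI - xI * yK) ^ 2 + (xI * yJ - xJ * yI) ^ 2) + 4 * s * l ^ 4 * (xJ * yK - xK * yJ) ^ 2 := by ring
  rw [e, hml, one_mul]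

/-- ★ **The second blow-up, pointwise**: for an axis hub (`a_J = a_K = 0` is not even needed here — only `4a_I²l² = ‖a‖² ≠ 0`) and
`4m²l² = 1`, `S³ w ∈ G⁴_s(a) ↔ w ∈ T(m², s l², 4 s l⁴)`. [folklore] -/
theorem scaleQ3_mem_rescaledSet4_iff {a : ℍ} {m l : ℝ} (hml : 4 * (m ^ 2 * l ^ 2) = 1) (hl : 4 * (a.imI ^ 2 * l ^ 2) = ‖a‖ ^ 2)
    (ha : ‖a‖ ≠ 0) (s : ℝ) (w : (ℍ × ℍ) × ℍ) :
    scaleQ3 m l w ∈ rescaledSet4 s a ↔ w ∈ twoScaleSet4 (m ^ 2) (s * l ^ 2) (4 * s * l ^ 4) := by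
  obtain ⟨⟨x, y⟩, z⟩ := w
  simp only [scaleQ3_apply, rescaledSet4, twoScaleSet4, Set.mem_setOf_eq, dilNormSq_scaleQ, scaleQ_imI, scaleQ_imJ, scaleQ_imK,
    hub_scale_iff hl ha, pair_scale_eq hml]

/-- ★★ **THE EXACT TWO-SCALE IDENTITY per hub**: for an axis hub with `a_I > 0` and ANY `s`,
`vol³(G⁴_s(a)) = (‖a‖/(4a_I))³ · vol³(T(a_I²/‖a‖², s‖a‖²/(4a_I²), s‖a‖⁴/(4a_I⁴)))`.  The power `a_I⁻³` is EXACTLY the one that cancels the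
cone density `‖Im a‖²d‖Im a‖` into `d‖Im a‖/‖Im a‖`. [folklore] -/
theorem volume_rescaledSet4_eq_twoScale {a : ℍ} (hI : 0 < a.imI) (s : ℝ) :
    (((volume : Measure ℍ).prod (volume : Measure ℍ)).prod (volume : Measure ℍ)) (rescaledSet4 s a) =
      ENNReal.ofReal ((‖a‖ / (4 * a.imI)) ^ 3) *
        (((volume : Measure ℍ).prod (volume : Measure ℍ)).prod (volume : Measure ℍ))
          (twoScaleSet4 (a.imI ^ 2 / ‖a‖ ^ 2) (s * ‖a‖ ^ 2 / (4 * a.imI ^ 2)) (s * ‖a‖ ^ 4 / (4 * a.imI ^ 4))) := by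
  have hI0 : a.imI ≠ 0 := hI.ne'
  have ha : ‖a‖ ≠ 0 := by
    intro h
    have h0 : a = 0 := norm_eq_zero.1 h
    rw [h0] at hI; simp at hI
  have hapos : 0 < ‖a‖ := lt_of_le_of_ne (norm_nonneg a) (Ne.symm ha)
  set m : ℝ := a.imI / ‖a‖ with hm
  set l : ℝ := ‖a‖ / (2 * a.imI) with hl
  have hml : 4 * (m ^ 2 * l ^ 2) = 1 := by rw [hm, hl]; field_simp; ring
  have hll : 4 * (a.imI ^ 2 * l ^ 2) = ‖a‖ ^ 2 := by rw [hl]; field_simp; ring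
  have hdet : m * l ^ 2 = ‖a‖ / (4 * a.imI) := by rw [hm, hl]; field_simp; ring
  have hdet_pos : 0 < m * l ^ 2 := by rw [hdet]; positivity
  have heta : m ^ 2 = a.imI ^ 2 / ‖a‖ ^ 2 := by rw [hm]; ring
  have hzeta : s * l ^ 2 = s * ‖a‖ ^ 2 / (4 * a.imI ^ 2) := by rw [hl]; field_simp; ring
  have hkappa : 4 * s * l ^ 4 = s * ‖a‖ ^ 4 / (4 * a.imI ^ 4) := by rw [hl]; field_simp; ring
  have hpre : scaleQ3 m l ⁻¹' rescaledSet4 s a = twoScaleSet4 (m ^ 2) (s * l ^ 2) (4 * s * l ^ 4) := by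
    ext w; exact scaleQ3_mem_rescaledSet4_iff hml hll ha s w
  rw [← heta, ← hzeta, ← hkappa, ← hpre, ← Measure.map_apply (measurable_scaleQ3 m l) (measurableSet_rescaledSet4 s a),
    map_scaleQ3_volume hdet_pos.ne', Measure.smul_apply, smul_eq_mul, ← mul_assoc, abs_of_pos hdet_pos, hdet]
  have hq : 0 < ‖a‖ / (4 * a.imI) := by positivity
  have hinv : ENNReal.ofReal (‖a‖ / (4 * a.imI)) * ENNReal.ofReal ((‖a‖ / (4 * a.imI))⁻¹) = 1 := by
    rw [← ENNReal.ofReal_mul hq.le, mul_inv_cancel₀ hq.ne', ENNReal.ofReal_one]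
  have h3 : ENNReal.ofReal ((‖a‖ / (4 * a.imI)) ^ 3) = ENNReal.ofReal (‖a‖ / (4 * a.imI)) * ENNReal.ofReal (‖a‖ / (4 * a.imI)) *
      ENNReal.ofReal (‖a‖ / (4 * a.imI)) := by
    rw [← ENNReal.ofReal_mul hq.le, ← ENNReal.ofReal_mul (by positivity)]; ring_nf
  rw [h3]
  symm
  calc ENNReal.ofReal (‖a‖ / (4 * a.imI)) * ENNReal.ofReal (‖a‖ / (4 * a.imI)) * ENNReal.ofReal (‖a‖ / (4 * a.imI)) *
        (ENNReal.ofReal (‖a‖ / (4 * a.imI))⁻¹ * ENNReal.ofReal (‖a‖ / (4 * a.imI))⁻¹ * ENNReal.ofReal (‖a‖ / (4 * a.imI))⁻¹) *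
        (((volume : Measure ℍ).prod (volume : Measure ℍ)).prod (volume : Measure ℍ)) (rescaledSet4 s a)
      = (ENNReal.ofReal (‖a‖ / (4 * a.imI)) * ENNReal.ofReal (‖a‖ / (4 * a.imI))⁻¹) *
          (ENNReal.ofReal (‖a‖ / (4 * a.imI)) * ENNReal.ofReal (‖a‖ / (4 * a.imI))⁻¹) *
          (ENNReal.ofReal (‖a‖ / (4 * a.imI)) * ENNReal.ofReal (‖a‖ / (4 * a.imI))⁻¹) *
          (((volume : Measure ℍ).prod (volume : Measure ℍ)).prod (volume : Measure ℍ)) (rescaledSet4 s a) := by ring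
    _ = _ := by rw [hinv, one_mul, one_mul, one_mul]

/-! ## §10 The exact two-scale formula for `Haar⁴(N₄(t))` -/

/-- Cone-a.e. the hub has `Im a ≠ 0`. [folklore] -/
theorem ae_cone_im_ne_zero : ∀ᵐ a : ℍ ∂coneMeasure, a.im ≠ 0 := by
  have hvol : ∀ᵐ a ∂(volume : Measure ℍ), a.im ≠ 0 := by
    have h : ∀ᵐ a ∂(volume : Measure ℍ), a.imJ ≠ 0 := by
      rw [ae_iff]; simpa only [ne_eq, not_not] using volume_imJ_eq_zero
    filter_upwards [h] with a ha him
    exact ha (by rw [← Quaternion.imJ_im, him]; rfl)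
  unfold coneMeasure
  exact Measure.ae_smul_measure (ae_restrict_of_ae hvol) _

/-- ★★★ **THE EXACT TWO-SCALE FORMULA**: for `t > 0`,
`Haar⁴(N₄(t)) = t⁶ · coneConst³ · ∫dcone(a) (‖a‖/(4‖Im a‖))³ · vol³(T(‖Im a‖²/‖a‖², t²‖a‖²/(4‖Im a‖²), t²‖a‖⁴/(4‖Im a‖⁴)))`.
Both blow-ups are exact; the logarithm of the two-sided laws is the `∫ d‖Im a‖/‖Im a‖` produced by the weight `‖Im a‖⁻³` against the cone density,
cut off below at `‖Im a‖ ≈ √t` by the third argument. [cite: Luscher1983, §2] -/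
theorem haar_nearlyCommuting_eq_twoScale {t : ℝ} (ht : 0 < t) :
    (Measure.pi fun _ : Fin 4 => haarProbability (Matrix.specialUnitaryGroup (Fin 2) ℂ)) (nearlyCommuting t) =
      ENNReal.ofReal (t ^ 6) * ((ENNReal.ofReal coneConst * ENNReal.ofReal coneConst * ENNReal.ofReal coneConst) *
        ∫⁻ a, ENNReal.ofReal ((‖a‖ / (4 * ‖a.im‖)) ^ 3) *
          (((volume : Measure ℍ).prod (volume : Measure ℍ)).prod (volume : Measure ℍ))
            (twoScaleSet4 (‖a.im‖ ^ 2 / ‖a‖ ^ 2) (t ^ 2 * ‖a‖ ^ 2 / (4 * ‖a.im‖ ^ 2)) (t ^ 2 * ‖a‖ ^ 4 / (4 * ‖a.im‖ ^ 4))) ∂coneMeasure) := by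
  rw [haar_nearlyCommuting_eq_scaled ht]
  congr 2
  refine lintegral_congr_ae ?_
  filter_upwards [ae_cone_im_ne_zero] with a ha
  have hI : 0 < (axisPoint a).imI := by rw [(axisPoint_components a).2.1]; exact norm_pos_iff.2 ha
  rw [volume_rescaledSet4_eq_twoScale hI, (axisPoint_components a).2.1, norm_axisPoint]

/-- The `η = ζ = 0` slice — **the limit event** `T(0, 0, κ)`: `x₀² < 1`, `x_J² + x_K² ≤ x₀²`,
`(x_Ky_I − x_Iy_K)² + (x_Iy_J − x_Jy_I)² + κ(x_Jy_K − x_Ky_J)² ≤ x₀²y₀²` (three letters, three pairs); antitone in `κ`. [folklore] -/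
theorem twoScaleSet4_zero_antitone {κ κ' : ℝ} (h : κ ≤ κ') : twoScaleSet4 0 0 κ' ⊆ twoScaleSet4 0 0 κ := by
  rintro ⟨⟨x, y⟩, z⟩ hw
  simp only [twoScaleSet4, Set.mem_setOf_eq] at hw ⊢
  obtain ⟨h1, h2, h3, h4, h5, h6, h7, h8, h9⟩ := hw
  refine ⟨h1, h2, h3, h4, h5, h6, ?_, ?_, ?_⟩
  · nlinarith [sq_nonneg (x.imJ * y.imK - x.imK * y.imJ)]
  · nlinarith [sq_nonneg (x.imJ * z.imK - x.imK * z.imJ)]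
  · nlinarith [sq_nonneg (y.imJ * z.imK - y.imK * z.imJ)]

end Summit.QuantumFields.YangMills.Theorems.SwapVirialDeficit.ZeroModeGroup

end
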